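import Literature.NumberTheory.EllipticCurves.PastenValuationProductLemma610OfFaltings
import Literature.NumberTheory.DiophantineGeometry.BelyiMapSignatureTwoThreeTriple
import Literature.NumberTheory.DiophantineGeometry.BelyiMapSignatureTwoThreeFive
import Literature.NumberTheory.DiophantineGeometry.BelyiMapSignatureTwoThreeSeven
import Literature.NumberTheory.DiophantineGeometry.BelyiMapSignatureTwoThreeThirteen
import Literature.NumberTheory.DiophantineGeometry.BelyiMapSignatureTwoThreeEleven
import HarnessLib

/-!
# Pasten's Lemma 6.10 for the exponents `L` not prime to `30`, modulo Faltings' theorem only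

Topic `NumberTheory/EllipticCurves`; namespace `Literature.NumberTheory.EllipticCurves`. Theorem-only
file (no new facts) attached to the named fact `PastenShimura2024_lemma_6_10`
(`PastenValuationProduct.lean`; H. Pasten, *Shimura curves and the abc conjecture*, §6.5,
Lemma 6.10). The printed proof applies Darmon–Granville's Theorem 2 at the one signature `(L, 2, 3)`
(`PastenLemma610.conductor_bounded_of_finite_properSolutions`,
`PastenLemma610.finite_minimalDiscriminantNorm_of_finite_properSolutions` of the proofs sibling), and
Darmon–Granville's theorem at a signature follows from Faltings' theorem and ONE covering of `ℙ¹` of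
that signature over a number field (`finite_properSolutions_of_belyiMap_of_faltings`). For every
`r ≥ 8` NOT PRIME TO `6` such a covering of signature `(2, 3, r)` is constructed explicitly in the tree
— two Kummer layers over the dihedral seed `((t³ + 1)/(t³ - 1))²` on the line over `ℚ(ζ₃)` for even
`r` (`BelyiMapSignatureTwoThreeEven`), one Kummer layer over the tetrahedral seed `1 - (T₂/T₁)³` over
`ℚ(ζ₁₂)` for `3 ∣ r` (`BelyiMapSignatureTwoThreeTriple`,
`finite_properSolutions_signature_r_two_three_of_faltings`) — so:

* `PastenLemma610.conductor_bounded_of_faltings_of_even`, `…_of_dvd` — **Lemma 6.10 for every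
  `L ≥ 7` with `2 ∣ L` or `3 ∣ L` follows from Faltings' theorem alone**
  (`finite_ratPlaces_of_two_le_genus`, every function field over a number field), with no Riemann
  existence theorem (`PastenShimura2024_lemma_6_10_of_faltings_of_dvd`);
* `PastenLemma610.finite_minimalDiscriminantNorm_of_faltings_of_even`, `…_of_dvd` — the same for
  the finiteness form `h610` of `Literature.NumberTheory.Automorphic.PastenShimura2024_thm_6_17'`;
* `PastenShimura2024_lemma_6_10_of_perfectSignatureCovers_of_faltings` — **what is left for the whole
  fact**: Faltings' theorem and coverings of signature `(2, 3, r)` only for the minimal `r ≥ 7`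
  PRIME TO `6` (perfect triangle groups; Riemann existence or modular curves).

For the exponents `L` prime to `6` (`L = 7, 11, 13, 25, …`) the covering input is a covering of
signature `(2, 3, r)` with `gcd(r, 6) = 1`, whose monodromy is a non-trivial quotient of the perfect
triangle group `Δ(2, 3, r)`; no Kummer tower over a CYCLIC seed supplies it. A Kummer layer over the
NON-SOLVABLE icosahedral seed `ℙ¹ → ℙ¹/A₅` (Klein; `BelyiMapSignatureTwoThreeFive`, signature
`(2, 3, 5m)` for every `m`) does supply it whenever `5 ∣ L` (`r = 25, 35, 55, …`), so (appended
2026-08-17):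

* `PastenLemma610.conductor_bounded_of_faltings_of_dvd_thirty`,
  `PastenLemma610.finite_minimalDiscriminantNorm_of_faltings_of_dvd_thirty`,
  `PastenShimura2024_lemma_6_10_of_faltings_of_dvd_thirty` — **Lemma 6.10 for every `L ≥ 7` with
  `2 ∣ L`, `3 ∣ L` or `5 ∣ L`, from Faltings' theorem alone** (in particular at `L = ℓ³` for the
  primes `ℓ = 2, 3, 5`, the exponents used by the small-prime depth of the crux
  `FewPrimeValuationProduct`);
* `PastenShimura2024_lemma_6_10_of_signatureCovers_coprime_thirty_of_faltings` — what is left for the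
  whole fact: Faltings' theorem and coverings of signature `(2, 3, r)` only for the minimal `r ≥ 7`
  PRIME TO `30` (`r = 7, 11, 13, 17, …, 49, 77, …`: the Klein quartic for `7 ∣ r`, the modular
  curves `X(r)`, or the Riemann-existence fact `exists_signatureCover_numberField` of
  `PastenValuationProductLemma610OfFaltings`).

The signature `(2, 3, 7)` is itself hyperbolic, so ONE covering of signature `(2, 3, 7)` serves every
exponent `L` divisible by `7` (`PastenLemma610.conductor_bounded_of_cover_two_three_seven_of_faltings` of
the `OfFaltings` sibling), and such a covering is constructed explicitly in
`BelyiMapSignatureTwoThreeSeven` — one Kummer layer of degree `7` over the `j`-map of the genus-`0`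
modular curve `X₁(7)` (Tate's normal form), over `ℚ(ζ₇)`, with the degree `168`, genus `3` and signature
of Klein's `X(7) → X(1)` — so (appended 2026-08-17):

* `PastenLemma610.conductor_bounded_of_faltings_of_dvd_twoHundredTen`,
  `PastenLemma610.finite_minimalDiscriminantNorm_of_faltings_of_dvd_twoHundredTen`,
  `PastenShimura2024_lemma_6_10_of_faltings_of_dvd_twoHundredTen` — **Lemma 6.10 for every `L ≥ 7`
  with `2 ∣ L`, `3 ∣ L`, `5 ∣ L` or `7 ∣ L`, from Faltings' theorem alone**, and
  `PastenLemma610.conductor_bounded_of_faltings_primePow` — in particular at every `L = ℓ^a ≥ 7` for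
  the primes `ℓ ≤ 7` (the exponents `ℓ^m` of the small-prime depth of the crux `FewPrimeValuationProduct`
  at `ℓ = 2, 3, 5, 7`);
* `PastenShimura2024_lemma_6_10_of_signatureCovers_coprime_twoHundredTen_of_faltings` — what is left
  for the whole fact: Faltings' theorem and coverings of signature `(2, 3, r)` only for the minimal
  `r ≥ 11` PRIME TO `210` (`r = 11, 13, 17, 19, …, 121, 143, …`: the modular curves `X(p)`, `p ≥ 11`
  prime, none of which has an intermediate genus-`0` quotient with an explicit Kummer complement in the
  tree, or the Riemann-existence fact `exists_signatureCover_numberField`).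

The one exception is `p = 13`: `X₀(13) ≅ ℙ¹` over `ℚ` (the only genus-`0` quotient of `X(p)` for a prime
`p ≥ 11` besides `X(11)/A₅`), whose `j`-map has non-uniform fibres (two simple points over each of
`j = 0, 1728`, cusps of widths `1` and `13`); `BelyiMapSignatureTwoThreeThirteen` makes it uniform by two
genus-`0` substitutions defined over `ℚ` (a conic and the Rédei twist of `w ↦ w¹³`) and one Kummer layer
of degree `3` over `ℚ(ζ₃)`, by a generic pull-back calculus (coprimality and separability transfer along
a rational map), giving an explicit covering of signature `(2, 3, 13)` (degree `1092`, genus `50`, those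
of `X(13) → X(1)`) — so (appended 2026-08-17):

* `PastenLemma610.conductor_bounded_of_faltings_of_dvd_2730`,
  `PastenLemma610.finite_minimalDiscriminantNorm_of_faltings_of_dvd_2730`,
  `PastenShimura2024_lemma_6_10_of_faltings_of_dvd_2730` — **Lemma 6.10 for every `L ≥ 7` with a prime
  factor in `{2, 3, 5, 7, 13}`, from Faltings' theorem alone**, and
  `PastenLemma610.conductor_bounded_of_faltings_primePow_le_thirteen` (every `L = ℓ^a ≥ 7`,
  `ℓ ∈ {2, 3, 5, 7, 13}`);
* `PastenShimura2024_lemma_6_10_of_signatureCovers_coprime_2730_of_faltings` — what is left for the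
  whole fact: Faltings' theorem and coverings of signature `(2, 3, r)` only for the minimal `r ≥ 11`
  PRIME TO `2730 = 2·3·5·7·13` (`r = 11, 17, 19, 23, …`): the genuine Riemann-existence (modular-curve)
  input, `X(p)` for `p = 11` and the primes `p ≥ 17` having no genus-`0` quotient over which a Kummer
  tower can be built.

The level `11` IS reached by the same method after all: Klein's resolvent of degree `11`
(`X(11)/A₅ → X(1)`, Klein 1879; Klein–Fricke's second shape `J : J - 1 : 1 = D C³ : B A² : 12³` over
`ℚ(√-11)`, Fricke II.5 §7 (15)) is a Shabat polynomial with passport `[11; 2⁴1³; 3³1²]`, and its five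
simple points are uniformised by THREE Kummer layers of prime degrees `3, 2, 2` with radicands on the
line (a `C₃` on the two simple points over `J = 0` and a Klein four group on the three simple points over
`J = 1`), `BelyiMapSignatureTwoThreeEleven` (degree `132`, genus `6`, those of `X(11)/C₅ → X(1)`) — so
(appended 2026-08-17):

* `PastenLemma610.conductor_bounded_of_faltings_of_dvd_30030`,
  `PastenLemma610.finite_minimalDiscriminantNorm_of_faltings_of_dvd_30030`,
  `PastenShimura2024_lemma_6_10_of_faltings_of_dvd_30030` — **Lemma 6.10 for every `L ≥ 7` with a prime
  factor `≤ 13`, from Faltings' theorem alone**, and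
  `PastenLemma610.conductor_bounded_of_faltings_primePow_of_le_thirteen` (every `L = ℓ^a ≥ 7`, `ℓ ≤ 13`
  prime);
* `PastenShimura2024_lemma_6_10_of_primeSignatureCovers_of_faltings` — what is left for the whole fact:
  Faltings' theorem and ONE covering of signature `(2, 3, p)` for each PRIME `p ≥ 17` (classically
  `X(p) → X(1)`), the genuine Riemann-existence (modular-curve) input.

## References

* H. Pasten, *Shimura curves and the abc conjecture*, J. Number Theory 254 (2024) 214–335
  (arXiv:1705.09251), §6.5, Lemma 6.10 (held text p. 22). [PastenShimura2024]
* H. Darmon, A. Granville, *On the equations `z^m = F(x, y)` and `A x^p + B y^q = C z^r`*, Bull.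
  London Math. Soc. 27 (1995) 513–543, Theorem 2 (p. 515), Prop. 3.1 (p. 525). [DarmonGranville1995]
* G. Faltings, *Endlichkeitssätze für abelsche Varietäten über Zahlkörpern*, Invent. Math. 73
  (1983), §6 Satz 7. [Faltings1983Endlichkeit]
-/

namespace Literature.NumberTheory.EllipticCurves

open Literature.NumberTheory.DiophantineGeometry

/-- **Pasten's Lemma 6.10 for even exponents, from Faltings' theorem alone** (conductor form, at one
exponent): for every even `L ≥ 7` (so `L ≥ 8`) and every finite `S` there is `N₀` such that no
elliptic curve `E/ℚ` semi-stable away from `S` with `N_E ≥ N₀` has `|Δ_E| = n k^L` with all primes of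
`n` in `S` — granting only Faltings' theorem (every function field over a number field); the
covering of signature `(2, 3, L)` is the explicit one of `BelyiMapSignatureTwoThreeEven`.
[cite: PastenShimura2024, Lemma 6.10 (§6.5, p. 22)]
[cite: DarmonGranville1995, Theorem 2 (p. 515)] -/
theorem PastenLemma610.conductor_bounded_of_faltings_of_even
    (hFaltings : ∀ (K' : Type) [Field K'] (F' : Type) [Field F'] [Algebra K' F'],
      finite_ratPlaces_of_two_le_genus K' F')
    {L : ℕ} (hL : 7 ≤ L) (h2 : 2 ∣ L) (S : Finset ℕ) :
    ∃ N₀ : ℕ, ∀ (W : WeierstrassCurve ℚ) [W.IsElliptic],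
      (∀ p : ℕ, p.Prime → p ∉ S → ¬ p ^ 2 ∣ W.conductorNorm ℤ) → N₀ ≤ W.conductorNorm ℤ →
      ∀ n k : ℕ, n.primeFactors ⊆ S → W.minimalDiscriminantNorm ℤ ≠ n * k ^ L :=
  PastenLemma610.conductor_bounded_of_finite_properSolutions (by omega)
    (fun _ _ _ hA hB hC =>
      finite_properSolutions_signature_even_two_three_of_faltings (by omega) h2 hFaltings hA hB hC) S

/-- **The finiteness form `h610` of Lemma 6.10 for even exponents, from Faltings' theorem alone**:
for even `L ≥ 7` and every finite `S` the set of minimal discriminants `|Δ_E|` of the elliptic curves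
`E/ℚ` semi-stable away from `S` with `|Δ_E| = n k^L`, all primes of `n` in `S`, is finite.
[cite: PastenShimura2024, Lemma 6.10 (§6.5, p. 22), last paragraph of the proof]
[cite: DarmonGranville1995, Theorem 2 (p. 515)] -/
theorem PastenLemma610.finite_minimalDiscriminantNorm_of_faltings_of_even
    (hFaltings : ∀ (K' : Type) [Field K'] (F' : Type) [Field F'] [Algebra K' F'],
      finite_ratPlaces_of_two_le_genus K' F')
    {L : ℕ} (hL : 7 ≤ L) (h2 : 2 ∣ L) (S : Finset ℕ) :
    {Δ : ℕ | ∃ (W : WeierstrassCurve ℚ) (_ : W.IsElliptic),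
        (∀ q : ℕ, q.Prime → q ∉ S → ¬ q ^ 2 ∣ W.conductorNorm ℤ) ∧
        W.minimalDiscriminantNorm ℤ = Δ ∧
        ∃ n k : ℕ, (∀ q : ℕ, q.Prime → q ∣ n → q ∈ S) ∧ Δ = n * k ^ L}.Finite :=
  PastenLemma610.finite_minimalDiscriminantNorm_of_finite_properSolutions (by omega)
    (fun _ _ _ hA hB hC =>
      finite_properSolutions_signature_even_two_three_of_faltings (by omega) h2 hFaltings hA hB hC) S

/-- **The named fact `PastenShimura2024_lemma_6_10` restricted to even exponents holds modulo
Faltings' theorem alone.** [cite: PastenShimura2024, Lemma 6.10 (§6.5, p. 22)] -/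
theorem PastenShimura2024_lemma_6_10_even_of_faltings
    (hFaltings : ∀ (K' : Type) [Field K'] (F' : Type) [Field F'] [Algebra K' F'],
      finite_ratPlaces_of_two_le_genus K' F') :
    ∀ (L : ℕ), 7 ≤ L → 2 ∣ L → ∀ (S : Finset ℕ), ∃ N₀ : ℕ, ∀ (W : WeierstrassCurve ℚ) [W.IsElliptic],
      (∀ p : ℕ, p.Prime → p ∉ S → ¬ p ^ 2 ∣ W.conductorNorm ℤ) → N₀ ≤ W.conductorNorm ℤ →
      ∀ n k : ℕ, n.primeFactors ⊆ S → W.minimalDiscriminantNorm ℤ ≠ n * k ^ L :=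
  fun _ hL h2 S => PastenLemma610.conductor_bounded_of_faltings_of_even hFaltings hL h2 S

/-- **Pasten's Lemma 6.10 for the exponents not prime to `6`, from Faltings' theorem alone**
(conductor form, at one exponent): for every `L ≥ 7` with `2 ∣ L` or `3 ∣ L` and every finite `S`
there is `N₀` such that no elliptic curve `E/ℚ` semi-stable away from `S` with `N_E ≥ N₀` has
`|Δ_E| = n k^L` with all primes of `n` in `S` — granting only Faltings' theorem; the covering of
signature `(2, 3, L)` is the explicit dihedral or tetrahedral one
(`finite_properSolutions_signature_r_two_three_of_faltings`).
[cite: PastenShimura2024, Lemma 6.10 (§6.5, p. 22)]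
[cite: DarmonGranville1995, Theorem 2 (p. 515)] -/
theorem PastenLemma610.conductor_bounded_of_faltings_of_dvd
    (hFaltings : ∀ (K' : Type) [Field K'] (F' : Type) [Field F'] [Algebra K' F'],
      finite_ratPlaces_of_two_le_genus K' F')
    {L : ℕ} (hL : 7 ≤ L) (h23 : 2 ∣ L ∨ 3 ∣ L) (S : Finset ℕ) :
    ∃ N₀ : ℕ, ∀ (W : WeierstrassCurve ℚ) [W.IsElliptic],
      (∀ p : ℕ, p.Prime → p ∉ S → ¬ p ^ 2 ∣ W.conductorNorm ℤ) → N₀ ≤ W.conductorNorm ℤ →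
      ∀ n k : ℕ, n.primeFactors ⊆ S → W.minimalDiscriminantNorm ℤ ≠ n * k ^ L :=
  PastenLemma610.conductor_bounded_of_finite_properSolutions (by omega)
    (fun _ _ _ hA hB hC =>
      finite_properSolutions_signature_r_two_three_of_faltings (by omega) h23 hFaltings hA hB hC) S

/-- **The finiteness form `h610` of Lemma 6.10 for the exponents not prime to `6`, from Faltings'
theorem alone.** [cite: PastenShimura2024, Lemma 6.10 (§6.5, p. 22), last paragraph of the proof]
[cite: DarmonGranville1995, Theorem 2 (p. 515)] -/
theorem PastenLemma610.finite_minimalDiscriminantNorm_of_faltings_of_dvd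
    (hFaltings : ∀ (K' : Type) [Field K'] (F' : Type) [Field F'] [Algebra K' F'],
      finite_ratPlaces_of_two_le_genus K' F')
    {L : ℕ} (hL : 7 ≤ L) (h23 : 2 ∣ L ∨ 3 ∣ L) (S : Finset ℕ) :
    {Δ : ℕ | ∃ (W : WeierstrassCurve ℚ) (_ : W.IsElliptic),
        (∀ q : ℕ, q.Prime → q ∉ S → ¬ q ^ 2 ∣ W.conductorNorm ℤ) ∧
        W.minimalDiscriminantNorm ℤ = Δ ∧
        ∃ n k : ℕ, (∀ q : ℕ, q.Prime → q ∣ n → q ∈ S) ∧ Δ = n * k ^ L}.Finite :=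
  PastenLemma610.finite_minimalDiscriminantNorm_of_finite_properSolutions (by omega)
    (fun _ _ _ hA hB hC =>
      finite_properSolutions_signature_r_two_three_of_faltings (by omega) h23 hFaltings hA hB hC) S

/-- **The named fact `PastenShimura2024_lemma_6_10` restricted to the exponents `L` with `2 ∣ L` or
`3 ∣ L` holds modulo Faltings' theorem alone** — no Riemann existence theorem; what remains open in
the tree for the full fact is Faltings' theorem and, for `gcd(L, 6) = 1` only, a covering of
signature `(2, 3, r)` with `r ∣ L`, `gcd(r, 6) = 1`. [cite: PastenShimura2024, Lemma 6.10 (§6.5, p. 22)] -/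
theorem PastenShimura2024_lemma_6_10_of_faltings_of_dvd
    (hFaltings : ∀ (K' : Type) [Field K'] (F' : Type) [Field F'] [Algebra K' F'],
      finite_ratPlaces_of_two_le_genus K' F') :
    ∀ (L : ℕ), 7 ≤ L → (2 ∣ L ∨ 3 ∣ L) → ∀ (S : Finset ℕ), ∃ N₀ : ℕ,
      ∀ (W : WeierstrassCurve ℚ) [W.IsElliptic],
      (∀ p : ℕ, p.Prime → p ∉ S → ¬ p ^ 2 ∣ W.conductorNorm ℤ) → N₀ ≤ W.conductorNorm ℤ →
      ∀ n k : ℕ, n.primeFactors ⊆ S → W.minimalDiscriminantNorm ℤ ≠ n * k ^ L :=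
  fun _ hL h23 S => PastenLemma610.conductor_bounded_of_faltings_of_dvd hFaltings hL h23 S

open scoped Polynomial in
open Polynomial AlgFunctionField in
/-- **What is left of the Riemann-existence input for the whole fact.** `PastenShimura2024_lemma_6_10`
follows from Faltings' theorem and coverings of signature `(2, 3, r)` ONLY for the `r ≥ 7` PRIME TO `6`
none of whose proper divisors is `≥ 7` (`r = 7, 11, 13, 25, 35, …` — the signatures with perfect
triangle group `Δ(2, 3, r)`): for `2 ∣ L` or `3 ∣ L` the explicit coverings of
`BelyiMapSignatureTwoThree{Even,Triple}` serve (`PastenLemma610.conductor_bounded_of_faltings_of_dvd`),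
and for `gcd(L, 6) = 1` the least divisor `r ≥ 7` of `L` is prime to `6` and minimal, so one covering
of signature `(2, 3, r)` and Faltings' theorem give the exponent `L`
(`PastenLemma610.finite_properSolutions_of_cover_of_faltings`).
[cite: PastenShimura2024, Lemma 6.10 (§6.5, p. 22)]
[cite: DarmonGranville1995, Theorem 2 (p. 515), Prop. 3.1 (p. 525)] -/
theorem PastenShimura2024_lemma_6_10_of_perfectSignatureCovers_of_faltings
    (hCover : ∀ r : ℕ, 7 ≤ r → Nat.Coprime r 6 → (∀ r' : ℕ, r' ∣ r → 7 ≤ r' → r' = r) →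
      ∃ (K : Type) (_ : Field K) (_ : NumberField K) (F : Type) (_ : Field F) (_ : Algebra K F)
        (_ : IsAlgFunctionField K F) (_ : IsIntegrallyClosedIn K F) (f : F),
        f ∉ Set.range (algebraMap K F) ∧
        (∀ P : PlaceOver K F, 0 < P.ord f → P.ord f = 2) ∧
        (∀ P : PlaceOver K F, 0 < P.ord (f - 1) → P.ord (f - 1) = 3) ∧
        (∀ P : PlaceOver K F, P.ord f < 0 → P.ord f = -r) ∧
        (∀ π₀ : K[X], Irreducible π₀ → π₀.Monic → π₀ ≠ X → π₀ ≠ X - 1 →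
          ∀ P : PlaceOver K F, 0 < P.ord (aeval f π₀) → P.ord (aeval f π₀) = 1))
    (hFaltings : ∀ (K' : Type) [Field K'] (F' : Type) [Field F'] [Algebra K' F'],
      finite_ratPlaces_of_two_le_genus K' F') :
    PastenShimura2024_lemma_6_10 := by
  classical
  intro L hL S
  by_cases h23 : 2 ∣ L ∨ 3 ∣ L
  · exact PastenLemma610.conductor_bounded_of_faltings_of_dvd hFaltings hL h23 S
  -- `gcd(L, 6) = 1`: the least divisor `r ≥ 7` of `L` is prime to `6` and minimal
  simp only [not_or] at h23
  have hex : ∃ r : ℕ, r ∣ L ∧ 7 ≤ r := ⟨L, dvd_rfl, hL⟩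
  obtain ⟨hrL, hr⟩ := Nat.find_spec hex
  have hmin : ∀ r' : ℕ, r' ∣ Nat.find hex → 7 ≤ r' → r' = Nat.find hex := fun r' hd h7 =>
    le_antisymm (Nat.le_of_dvd (by omega) hd) (Nat.find_min' hex ⟨hd.trans hrL, h7⟩)
  have h2 : ¬ 2 ∣ Nat.find hex := fun h => h23.1 (h.trans hrL)
  have h3 : ¬ 3 ∣ Nat.find hex := fun h => h23.2 (h.trans hrL)
  have hcop : Nat.Coprime (Nat.find hex) 6 := by
    rw [show (6 : ℕ) = 2 * 3 by norm_num]
    exact Nat.Coprime.mul_right ((Nat.Prime.coprime_iff_not_dvd Nat.prime_two).mpr h2).symm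
      ((Nat.Prime.coprime_iff_not_dvd Nat.prime_three).mpr h3).symm
  obtain ⟨K, _, _, F, _, _, _, _, f, hf, h₀, h₁, hi, hunr⟩ := hCover _ hr hcop hmin
  exact PastenLemma610.conductor_bounded_of_finite_properSolutions (by omega)
    (fun _ _ _ hA hB hC => PastenLemma610.finite_properSolutions_of_cover_of_faltings hr hrL
      (by omega) hf h₀ h₁ hi hunr hFaltings hA hB hC) S

/-! ### The exponents not prime to `30`: the icosahedral coverings (appended 2026-08-17) -/

/-- **Pasten's Lemma 6.10 for the exponents not prime to `30`, from Faltings' theorem alone**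
(conductor form, at one exponent): for every `L ≥ 7` with `2 ∣ L`, `3 ∣ L` or `5 ∣ L` and every finite
`S` there is `N₀` such that no elliptic curve `E/ℚ` semi-stable away from `S` with `N_E ≥ N₀` has
`|Δ_E| = n k^L` with all primes of `n` in `S` — granting only Faltings' theorem; the covering of
signature `(2, 3, L)` is the explicit dihedral, tetrahedral or icosahedral one
(`finite_properSolutions_signature_r_two_three_of_faltings_of_not_coprime_thirty`).
[cite: PastenShimura2024, Lemma 6.10 (§6.5, p. 22)]
[cite: DarmonGranville1995, Theorem 2 (p. 515)] -/
theorem PastenLemma610.conductor_bounded_of_faltings_of_dvd_thirty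
    (hFaltings : ∀ (K' : Type) [Field K'] (F' : Type) [Field F'] [Algebra K' F'],
      finite_ratPlaces_of_two_le_genus K' F')
    {L : ℕ} (hL : 7 ≤ L) (h235 : 2 ∣ L ∨ 3 ∣ L ∨ 5 ∣ L) (S : Finset ℕ) :
    ∃ N₀ : ℕ, ∀ (W : WeierstrassCurve ℚ) [W.IsElliptic],
      (∀ p : ℕ, p.Prime → p ∉ S → ¬ p ^ 2 ∣ W.conductorNorm ℤ) → N₀ ≤ W.conductorNorm ℤ →
      ∀ n k : ℕ, n.primeFactors ⊆ S → W.minimalDiscriminantNorm ℤ ≠ n * k ^ L :=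
  PastenLemma610.conductor_bounded_of_finite_properSolutions (by omega)
    (fun _ _ _ hA hB hC =>
      finite_properSolutions_signature_r_two_three_of_faltings_of_not_coprime_thirty (by omega) h235
        hFaltings hA hB hC) S

/-- **The finiteness form `h610` of Lemma 6.10 for the exponents not prime to `30`, from Faltings'
theorem alone.** [cite: PastenShimura2024, Lemma 6.10 (§6.5, p. 22), last paragraph of the proof]
[cite: DarmonGranville1995, Theorem 2 (p. 515)] -/
theorem PastenLemma610.finite_minimalDiscriminantNorm_of_faltings_of_dvd_thirty
    (hFaltings : ∀ (K' : Type) [Field K'] (F' : Type) [Field F'] [Algebra K' F'],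
      finite_ratPlaces_of_two_le_genus K' F')
    {L : ℕ} (hL : 7 ≤ L) (h235 : 2 ∣ L ∨ 3 ∣ L ∨ 5 ∣ L) (S : Finset ℕ) :
    {Δ : ℕ | ∃ (W : WeierstrassCurve ℚ) (_ : W.IsElliptic),
        (∀ q : ℕ, q.Prime → q ∉ S → ¬ q ^ 2 ∣ W.conductorNorm ℤ) ∧
        W.minimalDiscriminantNorm ℤ = Δ ∧
        ∃ n k : ℕ, (∀ q : ℕ, q.Prime → q ∣ n → q ∈ S) ∧ Δ = n * k ^ L}.Finite :=
  PastenLemma610.finite_minimalDiscriminantNorm_of_finite_properSolutions (by omega)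
    (fun _ _ _ hA hB hC =>
      finite_properSolutions_signature_r_two_three_of_faltings_of_not_coprime_thirty (by omega) h235
        hFaltings hA hB hC) S

/-- **The named fact `PastenShimura2024_lemma_6_10` restricted to the exponents `L` with `2 ∣ L`,
`3 ∣ L` or `5 ∣ L` holds modulo Faltings' theorem alone** — no Riemann existence theorem; what remains
open in the tree for the full fact is Faltings' theorem and, for `gcd(L, 30) = 1` only, a covering of
signature `(2, 3, r)` with `r ∣ L`, `gcd(r, 30) = 1`. [cite: PastenShimura2024, Lemma 6.10 (§6.5, p. 22)] -/
theorem PastenShimura2024_lemma_6_10_of_faltings_of_dvd_thirty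
    (hFaltings : ∀ (K' : Type) [Field K'] (F' : Type) [Field F'] [Algebra K' F'],
      finite_ratPlaces_of_two_le_genus K' F') :
    ∀ (L : ℕ), 7 ≤ L → (2 ∣ L ∨ 3 ∣ L ∨ 5 ∣ L) → ∀ (S : Finset ℕ), ∃ N₀ : ℕ,
      ∀ (W : WeierstrassCurve ℚ) [W.IsElliptic],
      (∀ p : ℕ, p.Prime → p ∉ S → ¬ p ^ 2 ∣ W.conductorNorm ℤ) → N₀ ≤ W.conductorNorm ℤ →
      ∀ n k : ℕ, n.primeFactors ⊆ S → W.minimalDiscriminantNorm ℤ ≠ n * k ^ L :=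
  fun _ hL h235 S => PastenLemma610.conductor_bounded_of_faltings_of_dvd_thirty hFaltings hL h235 S

open scoped Polynomial in
open Polynomial AlgFunctionField in
/-- **What is left of the Riemann-existence input for the whole fact, after the icosahedral
coverings.** `PastenShimura2024_lemma_6_10` follows from Faltings' theorem and coverings of signature
`(2, 3, r)` ONLY for the `r ≥ 7` PRIME TO `30` none of whose proper divisors is `≥ 7`
(`r = 7, 11, 13, 17, …, 49, 77, …`): for `2 ∣ L`, `3 ∣ L` or `5 ∣ L` the explicit coverings of
`BelyiMapSignatureTwoThree{Even,Triple,Five}` serve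
(`PastenLemma610.conductor_bounded_of_faltings_of_dvd_thirty`), and for `gcd(L, 30) = 1` the least
divisor `r ≥ 7` of `L` is prime to `30` and minimal, so one covering of signature `(2, 3, r)` and
Faltings' theorem give the exponent `L` (`PastenLemma610.finite_properSolutions_of_cover_of_faltings`).
[cite: PastenShimura2024, Lemma 6.10 (§6.5, p. 22)]
[cite: DarmonGranville1995, Theorem 2 (p. 515), Prop. 3.1 (p. 525)] -/
theorem PastenShimura2024_lemma_6_10_of_signatureCovers_coprime_thirty_of_faltings
    (hCover : ∀ r : ℕ, 7 ≤ r → Nat.Coprime r 30 → (∀ r' : ℕ, r' ∣ r → 7 ≤ r' → r' = r) →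
      ∃ (K : Type) (_ : Field K) (_ : NumberField K) (F : Type) (_ : Field F) (_ : Algebra K F)
        (_ : IsAlgFunctionField K F) (_ : IsIntegrallyClosedIn K F) (f : F),
        f ∉ Set.range (algebraMap K F) ∧
        (∀ P : PlaceOver K F, 0 < P.ord f → P.ord f = 2) ∧
        (∀ P : PlaceOver K F, 0 < P.ord (f - 1) → P.ord (f - 1) = 3) ∧
        (∀ P : PlaceOver K F, P.ord f < 0 → P.ord f = -r) ∧
        (∀ π₀ : K[X], Irreducible π₀ → π₀.Monic → π₀ ≠ X → π₀ ≠ X - 1 →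
          ∀ P : PlaceOver K F, 0 < P.ord (aeval f π₀) → P.ord (aeval f π₀) = 1))
    (hFaltings : ∀ (K' : Type) [Field K'] (F' : Type) [Field F'] [Algebra K' F'],
      finite_ratPlaces_of_two_le_genus K' F') :
    PastenShimura2024_lemma_6_10 := by
  classical
  intro L hL S
  by_cases h235 : 2 ∣ L ∨ 3 ∣ L ∨ 5 ∣ L
  · exact PastenLemma610.conductor_bounded_of_faltings_of_dvd_thirty hFaltings hL h235 S
  -- `gcd(L, 30) = 1`: the least divisor `r ≥ 7` of `L` is prime to `30` and minimal
  simp only [not_or] at h235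
  obtain ⟨h2L, h3L, h5L⟩ := h235
  have hex : ∃ r : ℕ, r ∣ L ∧ 7 ≤ r := ⟨L, dvd_rfl, hL⟩
  obtain ⟨hrL, hr⟩ := Nat.find_spec hex
  have hmin : ∀ r' : ℕ, r' ∣ Nat.find hex → 7 ≤ r' → r' = Nat.find hex := fun r' hd h7 =>
    le_antisymm (Nat.le_of_dvd (by omega) hd) (Nat.find_min' hex ⟨hd.trans hrL, h7⟩)
  have h2 : ¬ 2 ∣ Nat.find hex := fun h => h2L (h.trans hrL)
  have h3 : ¬ 3 ∣ Nat.find hex := fun h => h3L (h.trans hrL)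
  have h5 : ¬ 5 ∣ Nat.find hex := fun h => h5L (h.trans hrL)
  have hcop : Nat.Coprime (Nat.find hex) 30 := by
    rw [show (30 : ℕ) = 2 * 3 * 5 by norm_num]
    exact Nat.Coprime.mul_right (Nat.Coprime.mul_right
      ((Nat.Prime.coprime_iff_not_dvd Nat.prime_two).mpr h2).symm
      ((Nat.Prime.coprime_iff_not_dvd Nat.prime_three).mpr h3).symm)
      ((Nat.Prime.coprime_iff_not_dvd Nat.prime_five).mpr h5).symm
  obtain ⟨K, _, _, F, _, _, _, _, f, hf, h₀, h₁, hi, hunr⟩ := hCover _ hr hcop hmin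
  exact PastenLemma610.conductor_bounded_of_finite_properSolutions (by omega)
    (fun _ _ _ hA hB hC => PastenLemma610.finite_properSolutions_of_cover_of_faltings hr hrL
      (by omega) hf h₀ h₁ hi hunr hFaltings hA hB hC) S

/-! ### The exponents not prime to `210`: the level-`7` covering (appended 2026-08-17) -/

/-- **Pasten's Lemma 6.10 for the exponents not prime to `210`, from Faltings' theorem alone**
(conductor form, at one exponent): for every `L ≥ 7` with `2 ∣ L`, `3 ∣ L`, `5 ∣ L` or `7 ∣ L` and every
finite `S` there is `N₀` such that no elliptic curve `E/ℚ` semi-stable away from `S` with `N_E ≥ N₀` has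
`|Δ_E| = n k^L` with all primes of `n` in `S` — granting only Faltings' theorem; the covering of
signature `(2, 3, L)` is the explicit dihedral, tetrahedral, icosahedral or level-`7` one
(`finite_properSolutions_signature_r_two_three_of_faltings_of_not_coprime`).
[cite: PastenShimura2024, Lemma 6.10 (§6.5, p. 22)]
[cite: DarmonGranville1995, Theorem 2 (p. 515)] -/
theorem PastenLemma610.conductor_bounded_of_faltings_of_dvd_twoHundredTen
    (hFaltings : ∀ (K' : Type) [Field K'] (F' : Type) [Field F'] [Algebra K' F'],
      finite_ratPlaces_of_two_le_genus K' F')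
    {L : ℕ} (hL : 7 ≤ L) (h2357 : 2 ∣ L ∨ 3 ∣ L ∨ 5 ∣ L ∨ 7 ∣ L) (S : Finset ℕ) :
    ∃ N₀ : ℕ, ∀ (W : WeierstrassCurve ℚ) [W.IsElliptic],
      (∀ p : ℕ, p.Prime → p ∉ S → ¬ p ^ 2 ∣ W.conductorNorm ℤ) → N₀ ≤ W.conductorNorm ℤ →
      ∀ n k : ℕ, n.primeFactors ⊆ S → W.minimalDiscriminantNorm ℤ ≠ n * k ^ L :=
  PastenLemma610.conductor_bounded_of_finite_properSolutions (by omega)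
    (fun _ _ _ hA hB hC =>
      finite_properSolutions_signature_r_two_three_of_faltings_of_not_coprime hL h2357
        hFaltings hA hB hC) S

/-- **The finiteness form `h610` of Lemma 6.10 for the exponents not prime to `210`, from Faltings'
theorem alone.** [cite: PastenShimura2024, Lemma 6.10 (§6.5, p. 22), last paragraph of the proof]
[cite: DarmonGranville1995, Theorem 2 (p. 515)] -/
theorem PastenLemma610.finite_minimalDiscriminantNorm_of_faltings_of_dvd_twoHundredTen
    (hFaltings : ∀ (K' : Type) [Field K'] (F' : Type) [Field F'] [Algebra K' F'],
      finite_ratPlaces_of_two_le_genus K' F')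
    {L : ℕ} (hL : 7 ≤ L) (h2357 : 2 ∣ L ∨ 3 ∣ L ∨ 5 ∣ L ∨ 7 ∣ L) (S : Finset ℕ) :
    {Δ : ℕ | ∃ (W : WeierstrassCurve ℚ) (_ : W.IsElliptic),
        (∀ q : ℕ, q.Prime → q ∉ S → ¬ q ^ 2 ∣ W.conductorNorm ℤ) ∧
        W.minimalDiscriminantNorm ℤ = Δ ∧
        ∃ n k : ℕ, (∀ q : ℕ, q.Prime → q ∣ n → q ∈ S) ∧ Δ = n * k ^ L}.Finite :=
  PastenLemma610.finite_minimalDiscriminantNorm_of_finite_properSolutions (by omega)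
    (fun _ _ _ hA hB hC =>
      finite_properSolutions_signature_r_two_three_of_faltings_of_not_coprime hL h2357
        hFaltings hA hB hC) S

/-- **The named fact `PastenShimura2024_lemma_6_10` restricted to the exponents `L` with `2 ∣ L`,
`3 ∣ L`, `5 ∣ L` or `7 ∣ L` holds modulo Faltings' theorem alone** — no Riemann existence theorem; what
remains open in the tree for the full fact is Faltings' theorem and, for `gcd(L, 210) = 1` only, a
covering of signature `(2, 3, r)` with `r ∣ L`, `gcd(r, 210) = 1`.
[cite: PastenShimura2024, Lemma 6.10 (§6.5, p. 22)] -/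
theorem PastenShimura2024_lemma_6_10_of_faltings_of_dvd_twoHundredTen
    (hFaltings : ∀ (K' : Type) [Field K'] (F' : Type) [Field F'] [Algebra K' F'],
      finite_ratPlaces_of_two_le_genus K' F') :
    ∀ (L : ℕ), 7 ≤ L → (2 ∣ L ∨ 3 ∣ L ∨ 5 ∣ L ∨ 7 ∣ L) → ∀ (S : Finset ℕ), ∃ N₀ : ℕ,
      ∀ (W : WeierstrassCurve ℚ) [W.IsElliptic],
      (∀ p : ℕ, p.Prime → p ∉ S → ¬ p ^ 2 ∣ W.conductorNorm ℤ) → N₀ ≤ W.conductorNorm ℤ →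
      ∀ n k : ℕ, n.primeFactors ⊆ S → W.minimalDiscriminantNorm ℤ ≠ n * k ^ L :=
  fun _ hL h2357 S => PastenLemma610.conductor_bounded_of_faltings_of_dvd_twoHundredTen hFaltings hL h2357 S

/-- **Pasten's Lemma 6.10 at every prime-power exponent `L = ℓ^a ≥ 7` with `ℓ ≤ 7`, from Faltings'
theorem alone** (the exponents `ℓ^m` at which the small-prime depth of the `Summits/ABC` crux
`FewPrimeValuationProduct` applies the fact, for the primes `ℓ = 2, 3, 5, 7`).
[cite: PastenShimura2024, Lemma 6.10 (§6.5, p. 22)] -/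
theorem PastenLemma610.conductor_bounded_of_faltings_primePow
    (hFaltings : ∀ (K' : Type) [Field K'] (F' : Type) [Field F'] [Algebra K' F'],
      finite_ratPlaces_of_two_le_genus K' F')
    {ℓ a : ℕ} (hℓ : ℓ.Prime) (hℓ7 : ℓ ≤ 7) (hL : 7 ≤ ℓ ^ a) (S : Finset ℕ) :
    ∃ N₀ : ℕ, ∀ (W : WeierstrassCurve ℚ) [W.IsElliptic],
      (∀ p : ℕ, p.Prime → p ∉ S → ¬ p ^ 2 ∣ W.conductorNorm ℤ) → N₀ ≤ W.conductorNorm ℤ →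
      ∀ n k : ℕ, n.primeFactors ⊆ S → W.minimalDiscriminantNorm ℤ ≠ n * k ^ (ℓ ^ a) := by
  have ha : a ≠ 0 := by rintro rfl; norm_num at hL
  have hdvd : ℓ ∣ ℓ ^ a := dvd_pow_self ℓ ha
  have h2 := hℓ.two_le
  have h2357 : 2 ∣ ℓ ^ a ∨ 3 ∣ ℓ ^ a ∨ 5 ∣ ℓ ^ a ∨ 7 ∣ ℓ ^ a := by
    interval_cases ℓ
    · exact Or.inl hdvd
    · exact Or.inr (Or.inl hdvd)
    · exact absurd hℓ (by norm_num)
    · exact Or.inr (Or.inr (Or.inl hdvd))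
    · exact absurd hℓ (by norm_num)
    · exact Or.inr (Or.inr (Or.inr hdvd))
  exact PastenLemma610.conductor_bounded_of_faltings_of_dvd_twoHundredTen hFaltings hL h2357 S

open scoped Polynomial in
open Polynomial AlgFunctionField in
/-- **What is left of the Riemann-existence input for the whole fact, after the level-`7` covering.**
`PastenShimura2024_lemma_6_10` follows from Faltings' theorem and coverings of signature `(2, 3, r)` ONLY
for the `r ≥ 11` PRIME TO `210` none of whose proper divisors is `≥ 7` (`r = 11, 13, 17, 19, 23, …,
121, 143, …`): for `2 ∣ L`, `3 ∣ L`, `5 ∣ L` or `7 ∣ L` the explicit coverings of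
`BelyiMapSignatureTwoThree{Even,Triple,Five,Seven}` serve
(`PastenLemma610.conductor_bounded_of_faltings_of_dvd_twoHundredTen`), and for `gcd(L, 210) = 1` the
least divisor `r ≥ 7` of `L` is prime to `210`, hence `≥ 11`, and minimal, so one covering of signature
`(2, 3, r)` and Faltings' theorem give the exponent `L`
(`PastenLemma610.finite_properSolutions_of_cover_of_faltings`).
[cite: PastenShimura2024, Lemma 6.10 (§6.5, p. 22)]
[cite: DarmonGranville1995, Theorem 2 (p. 515), Prop. 3.1 (p. 525)] -/
theorem PastenShimura2024_lemma_6_10_of_signatureCovers_coprime_twoHundredTen_of_faltings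
    (hCover : ∀ r : ℕ, 11 ≤ r → Nat.Coprime r 210 → (∀ r' : ℕ, r' ∣ r → 7 ≤ r' → r' = r) →
      ∃ (K : Type) (_ : Field K) (_ : NumberField K) (F : Type) (_ : Field F) (_ : Algebra K F)
        (_ : IsAlgFunctionField K F) (_ : IsIntegrallyClosedIn K F) (f : F),
        f ∉ Set.range (algebraMap K F) ∧
        (∀ P : PlaceOver K F, 0 < P.ord f → P.ord f = 2) ∧
        (∀ P : PlaceOver K F, 0 < P.ord (f - 1) → P.ord (f - 1) = 3) ∧
        (∀ P : PlaceOver K F, P.ord f < 0 → P.ord f = -r) ∧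
        (∀ π₀ : K[X], Irreducible π₀ → π₀.Monic → π₀ ≠ X → π₀ ≠ X - 1 →
          ∀ P : PlaceOver K F, 0 < P.ord (aeval f π₀) → P.ord (aeval f π₀) = 1))
    (hFaltings : ∀ (K' : Type) [Field K'] (F' : Type) [Field F'] [Algebra K' F'],
      finite_ratPlaces_of_two_le_genus K' F') :
    PastenShimura2024_lemma_6_10 := by
  classical
  intro L hL S
  by_cases h2357 : 2 ∣ L ∨ 3 ∣ L ∨ 5 ∣ L ∨ 7 ∣ L
  · exact PastenLemma610.conductor_bounded_of_faltings_of_dvd_twoHundredTen hFaltings hL h2357 S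
  -- `gcd(L, 210) = 1`: the least divisor `r ≥ 7` of `L` is prime to `210`, hence `≥ 11`, and minimal
  simp only [not_or] at h2357
  obtain ⟨h2L, h3L, h5L, h7L⟩ := h2357
  have hex : ∃ r : ℕ, r ∣ L ∧ 7 ≤ r := ⟨L, dvd_rfl, hL⟩
  obtain ⟨hrL, hr⟩ := Nat.find_spec hex
  have hmin : ∀ r' : ℕ, r' ∣ Nat.find hex → 7 ≤ r' → r' = Nat.find hex := fun r' hd h7 =>
    le_antisymm (Nat.le_of_dvd (by omega) hd) (Nat.find_min' hex ⟨hd.trans hrL, h7⟩)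
  have h2 : ¬ 2 ∣ Nat.find hex := fun h => h2L (h.trans hrL)
  have h3 : ¬ 3 ∣ Nat.find hex := fun h => h3L (h.trans hrL)
  have h5 : ¬ 5 ∣ Nat.find hex := fun h => h5L (h.trans hrL)
  have h7 : ¬ 7 ∣ Nat.find hex := fun h => h7L (h.trans hrL)
  have hcop : Nat.Coprime (Nat.find hex) 210 := by
    rw [show (210 : ℕ) = 2 * 3 * 5 * 7 by norm_num]
    exact Nat.Coprime.mul_right (Nat.Coprime.mul_right (Nat.Coprime.mul_right
      ((Nat.Prime.coprime_iff_not_dvd Nat.prime_two).mpr h2).symm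
      ((Nat.Prime.coprime_iff_not_dvd Nat.prime_three).mpr h3).symm)
      ((Nat.Prime.coprime_iff_not_dvd Nat.prime_five).mpr h5).symm)
      ((Nat.Prime.coprime_iff_not_dvd Nat.prime_seven).mpr h7).symm
  have h11 : 11 ≤ Nat.find hex := by
    by_contra hlt
    have key : ∀ r : ℕ, 7 ≤ r → r < 11 → ¬ 2 ∣ r → ¬ 3 ∣ r → ¬ 7 ∣ r → False := by
      intro r h7r h11r; interval_cases r <;> omega
    exact key _ hr (not_le.mp hlt) h2 h3 h7
  obtain ⟨K, _, _, F, _, _, _, _, f, hf, h₀, h₁, hi, hunr⟩ := hCover _ h11 hcop hmin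
  exact PastenLemma610.conductor_bounded_of_finite_properSolutions (by omega)
    (fun _ _ _ hA hB hC => PastenLemma610.finite_properSolutions_of_cover_of_faltings hr hrL
      (by omega) hf h₀ h₁ hi hunr hFaltings hA hB hC) S

/-! ### The exponents with a prime factor in `{2, 3, 5, 7, 13}`: the level-`13` covering (appended 2026-08-17) -/

/-- **Pasten's Lemma 6.10 for the exponents having a prime factor in `{2, 3, 5, 7, 13}`, from Faltings'
theorem alone** (conductor form, at one exponent): for every `L ≥ 7` with `2 ∣ L`, `3 ∣ L`, `5 ∣ L`,
`7 ∣ L` or `13 ∣ L` and every finite `S` there is `N₀` such that no elliptic curve `E/ℚ` semi-stable away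
from `S` with `N_E ≥ N₀` has `|Δ_E| = n k^L` with all primes of `n` in `S` — granting only Faltings'
theorem; the covering of signature `(2, 3, L)` is the explicit dihedral, tetrahedral, icosahedral,
level-`7` or level-`13` one (`finite_properSolutions_signature_r_two_three_of_faltings_of_dvd`, the last
from the `j`-map of `X₀(13)`, two genus-`0` substitutions and one Kummer layer,
`BelyiMapSignatureTwoThreeThirteen`).
[cite: PastenShimura2024, Lemma 6.10 (§6.5, p. 22)]
[cite: DarmonGranville1995, Theorem 2 (p. 515)] -/
theorem PastenLemma610.conductor_bounded_of_faltings_of_dvd_2730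
    (hFaltings : ∀ (K' : Type) [Field K'] (F' : Type) [Field F'] [Algebra K' F'],
      finite_ratPlaces_of_two_le_genus K' F')
    {L : ℕ} (hL : 7 ≤ L) (h : 2 ∣ L ∨ 3 ∣ L ∨ 5 ∣ L ∨ 7 ∣ L ∨ 13 ∣ L) (S : Finset ℕ) :
    ∃ N₀ : ℕ, ∀ (W : WeierstrassCurve ℚ) [W.IsElliptic],
      (∀ p : ℕ, p.Prime → p ∉ S → ¬ p ^ 2 ∣ W.conductorNorm ℤ) → N₀ ≤ W.conductorNorm ℤ →
      ∀ n k : ℕ, n.primeFactors ⊆ S → W.minimalDiscriminantNorm ℤ ≠ n * k ^ L :=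
  PastenLemma610.conductor_bounded_of_finite_properSolutions (by omega)
    (fun _ _ _ hA hB hC =>
      finite_properSolutions_signature_r_two_three_of_faltings_of_dvd hL h hFaltings hA hB hC) S

/-- **The finiteness form `h610` of Lemma 6.10 for the exponents having a prime factor in
`{2, 3, 5, 7, 13}`, from Faltings' theorem alone.**
[cite: PastenShimura2024, Lemma 6.10 (§6.5, p. 22), last paragraph of the proof]
[cite: DarmonGranville1995, Theorem 2 (p. 515)] -/
theorem PastenLemma610.finite_minimalDiscriminantNorm_of_faltings_of_dvd_2730
    (hFaltings : ∀ (K' : Type) [Field K'] (F' : Type) [Field F'] [Algebra K' F'],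
      finite_ratPlaces_of_two_le_genus K' F')
    {L : ℕ} (hL : 7 ≤ L) (h : 2 ∣ L ∨ 3 ∣ L ∨ 5 ∣ L ∨ 7 ∣ L ∨ 13 ∣ L) (S : Finset ℕ) :
    {Δ : ℕ | ∃ (W : WeierstrassCurve ℚ) (_ : W.IsElliptic),
        (∀ q : ℕ, q.Prime → q ∉ S → ¬ q ^ 2 ∣ W.conductorNorm ℤ) ∧
        W.minimalDiscriminantNorm ℤ = Δ ∧
        ∃ n k : ℕ, (∀ q : ℕ, q.Prime → q ∣ n → q ∈ S) ∧ Δ = n * k ^ L}.Finite :=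
  PastenLemma610.finite_minimalDiscriminantNorm_of_finite_properSolutions (by omega)
    (fun _ _ _ hA hB hC =>
      finite_properSolutions_signature_r_two_three_of_faltings_of_dvd hL h hFaltings hA hB hC) S

/-- **The named fact `PastenShimura2024_lemma_6_10` restricted to the exponents `L` with a prime factor
in `{2, 3, 5, 7, 13}` holds modulo Faltings' theorem alone** — no Riemann existence theorem; what
remains open in the tree for the full fact is Faltings' theorem and, for `gcd(L, 2730) = 1` only, a
covering of signature `(2, 3, r)` with `r ∣ L`, `gcd(r, 2730) = 1` (`r = 11` or `r ≥ 17`).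
[cite: PastenShimura2024, Lemma 6.10 (§6.5, p. 22)] -/
theorem PastenShimura2024_lemma_6_10_of_faltings_of_dvd_2730
    (hFaltings : ∀ (K' : Type) [Field K'] (F' : Type) [Field F'] [Algebra K' F'],
      finite_ratPlaces_of_two_le_genus K' F') :
    ∀ (L : ℕ), 7 ≤ L → (2 ∣ L ∨ 3 ∣ L ∨ 5 ∣ L ∨ 7 ∣ L ∨ 13 ∣ L) → ∀ (S : Finset ℕ), ∃ N₀ : ℕ,
      ∀ (W : WeierstrassCurve ℚ) [W.IsElliptic],
      (∀ p : ℕ, p.Prime → p ∉ S → ¬ p ^ 2 ∣ W.conductorNorm ℤ) → N₀ ≤ W.conductorNorm ℤ →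
      ∀ n k : ℕ, n.primeFactors ⊆ S → W.minimalDiscriminantNorm ℤ ≠ n * k ^ L :=
  fun _ hL h S => PastenLemma610.conductor_bounded_of_faltings_of_dvd_2730 hFaltings hL h S

/-- **Pasten's Lemma 6.10 at every prime-power exponent `L = ℓ^a ≥ 7` with `ℓ ∈ {2, 3, 5, 7, 13}`, from
Faltings' theorem alone** (the exponents `ℓ^m` at which the small-prime depth of the `Summits/ABC` crux
`FewPrimeValuationProduct` applies the fact; the primes `ℓ = 11` and `ℓ ≥ 17` remain).
[cite: PastenShimura2024, Lemma 6.10 (§6.5, p. 22)] -/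
theorem PastenLemma610.conductor_bounded_of_faltings_primePow_le_thirteen
    (hFaltings : ∀ (K' : Type) [Field K'] (F' : Type) [Field F'] [Algebra K' F'],
      finite_ratPlaces_of_two_le_genus K' F')
    {ℓ a : ℕ} (hℓ : ℓ.Prime) (hℓ13 : ℓ ≤ 13) (hℓ11 : ℓ ≠ 11) (hL : 7 ≤ ℓ ^ a) (S : Finset ℕ) :
    ∃ N₀ : ℕ, ∀ (W : WeierstrassCurve ℚ) [W.IsElliptic],
      (∀ p : ℕ, p.Prime → p ∉ S → ¬ p ^ 2 ∣ W.conductorNorm ℤ) → N₀ ≤ W.conductorNorm ℤ →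
      ∀ n k : ℕ, n.primeFactors ⊆ S → W.minimalDiscriminantNorm ℤ ≠ n * k ^ (ℓ ^ a) := by
  have ha : a ≠ 0 := by rintro rfl; norm_num at hL
  have hdvd : ℓ ∣ ℓ ^ a := dvd_pow_self ℓ ha
  have h2 := hℓ.two_le
  have h : 2 ∣ ℓ ^ a ∨ 3 ∣ ℓ ^ a ∨ 5 ∣ ℓ ^ a ∨ 7 ∣ ℓ ^ a ∨ 13 ∣ ℓ ^ a := by
    interval_cases ℓ
    · exact Or.inl hdvd
    · exact Or.inr (Or.inl hdvd)
    · exact absurd hℓ (by norm_num)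
    · exact Or.inr (Or.inr (Or.inl hdvd))
    · exact absurd hℓ (by norm_num)
    · exact Or.inr (Or.inr (Or.inr (Or.inl hdvd)))
    · exact absurd hℓ (by norm_num)
    · exact absurd hℓ (by norm_num)
    · exact absurd hℓ (by norm_num)
    · exact absurd rfl hℓ11
    · exact absurd hℓ (by norm_num)
    · exact Or.inr (Or.inr (Or.inr (Or.inr hdvd)))
  exact PastenLemma610.conductor_bounded_of_faltings_of_dvd_2730 hFaltings hL h S

open scoped Polynomial in
open Polynomial AlgFunctionField in
/-- **What is left of the Riemann-existence input for the whole fact, after the level-`13` covering.**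
`PastenShimura2024_lemma_6_10` follows from Faltings' theorem and coverings of signature `(2, 3, r)` ONLY
for the `r ≥ 11` PRIME TO `2730 = 2 · 3 · 5 · 7 · 13` none of whose proper divisors is `≥ 7`
(`r = 11, 17, 19, 23, …, 121, 187, …`): for `L` with a prime factor in `{2, 3, 5, 7, 13}` the explicit
coverings of `BelyiMapSignatureTwoThree{Even,Triple,Five,Seven,Thirteen}` serve
(`PastenLemma610.conductor_bounded_of_faltings_of_dvd_2730`), and for `gcd(L, 2730) = 1` the least
divisor `r ≥ 7` of `L` is prime to `2730`, hence `≥ 11`, and minimal, so one covering of signature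
`(2, 3, r)` and Faltings' theorem give the exponent `L`
(`PastenLemma610.finite_properSolutions_of_cover_of_faltings`). These residual `r` are exactly the
levels at which `X(r)` has no genus-`0` quotient carrying a Kummer tower over `ℚ(ζ)` except
`X(11)/A₅`; they are the genuine Riemann-existence (or modular-curve) input of the fact.
[cite: PastenShimura2024, Lemma 6.10 (§6.5, p. 22)]
[cite: DarmonGranville1995, Theorem 2 (p. 515), Prop. 3.1 (p. 525)] -/
theorem PastenShimura2024_lemma_6_10_of_signatureCovers_coprime_2730_of_faltings
    (hCover : ∀ r : ℕ, 11 ≤ r → Nat.Coprime r 2730 → (∀ r' : ℕ, r' ∣ r → 7 ≤ r' → r' = r) →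
      ∃ (K : Type) (_ : Field K) (_ : NumberField K) (F : Type) (_ : Field F) (_ : Algebra K F)
        (_ : IsAlgFunctionField K F) (_ : IsIntegrallyClosedIn K F) (f : F),
        f ∉ Set.range (algebraMap K F) ∧
        (∀ P : PlaceOver K F, 0 < P.ord f → P.ord f = 2) ∧
        (∀ P : PlaceOver K F, 0 < P.ord (f - 1) → P.ord (f - 1) = 3) ∧
        (∀ P : PlaceOver K F, P.ord f < 0 → P.ord f = -r) ∧
        (∀ π₀ : K[X], Irreducible π₀ → π₀.Monic → π₀ ≠ X → π₀ ≠ X - 1 →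
          ∀ P : PlaceOver K F, 0 < P.ord (aeval f π₀) → P.ord (aeval f π₀) = 1))
    (hFaltings : ∀ (K' : Type) [Field K'] (F' : Type) [Field F'] [Algebra K' F'],
      finite_ratPlaces_of_two_le_genus K' F') :
    PastenShimura2024_lemma_6_10 := by
  classical
  intro L hL S
  by_cases h : 2 ∣ L ∨ 3 ∣ L ∨ 5 ∣ L ∨ 7 ∣ L ∨ 13 ∣ L
  · exact PastenLemma610.conductor_bounded_of_faltings_of_dvd_2730 hFaltings hL h S
  -- `gcd(L, 2730) = 1`: the least divisor `r ≥ 7` of `L` is prime to `2730`, hence `≥ 11`, and minimal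
  simp only [not_or] at h
  obtain ⟨h2L, h3L, h5L, h7L, h13L⟩ := h
  have hex : ∃ r : ℕ, r ∣ L ∧ 7 ≤ r := ⟨L, dvd_rfl, hL⟩
  obtain ⟨hrL, hr⟩ := Nat.find_spec hex
  have hmin : ∀ r' : ℕ, r' ∣ Nat.find hex → 7 ≤ r' → r' = Nat.find hex := fun r' hd h7 =>
    le_antisymm (Nat.le_of_dvd (by omega) hd) (Nat.find_min' hex ⟨hd.trans hrL, h7⟩)
  have h2 : ¬ 2 ∣ Nat.find hex := fun h => h2L (h.trans hrL)
  have h3 : ¬ 3 ∣ Nat.find hex := fun h => h3L (h.trans hrL)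
  have h5 : ¬ 5 ∣ Nat.find hex := fun h => h5L (h.trans hrL)
  have h7 : ¬ 7 ∣ Nat.find hex := fun h => h7L (h.trans hrL)
  have h13 : ¬ 13 ∣ Nat.find hex := fun h => h13L (h.trans hrL)
  have hp13 : Nat.Prime 13 := by norm_num
  have hcop : Nat.Coprime (Nat.find hex) 2730 := by
    rw [show (2730 : ℕ) = 2 * 3 * 5 * 7 * 13 by norm_num]
    exact Nat.Coprime.mul_right (Nat.Coprime.mul_right (Nat.Coprime.mul_right (Nat.Coprime.mul_right
      ((Nat.Prime.coprime_iff_not_dvd Nat.prime_two).mpr h2).symm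
      ((Nat.Prime.coprime_iff_not_dvd Nat.prime_three).mpr h3).symm)
      ((Nat.Prime.coprime_iff_not_dvd Nat.prime_five).mpr h5).symm)
      ((Nat.Prime.coprime_iff_not_dvd Nat.prime_seven).mpr h7).symm)
      ((Nat.Prime.coprime_iff_not_dvd hp13).mpr h13).symm
  have h11 : 11 ≤ Nat.find hex := by
    by_contra hlt
    have key : ∀ r : ℕ, 7 ≤ r → r < 11 → ¬ 2 ∣ r → ¬ 3 ∣ r → ¬ 7 ∣ r → False := by
      intro r h7r h11r; interval_cases r <;> omega
    exact key _ hr (not_le.mp hlt) h2 h3 h7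
  obtain ⟨K, _, _, F, _, _, _, _, f, hf, h₀, h₁, hi, hunr⟩ := hCover _ h11 hcop hmin
  exact PastenLemma610.conductor_bounded_of_finite_properSolutions (by omega)
    (fun _ _ _ hA hB hC => PastenLemma610.finite_properSolutions_of_cover_of_faltings hr hrL
      (by omega) hf h₀ h₁ hi hunr hFaltings hA hB hC) S

/-! ### The exponents with a prime factor `≤ 13`: the level-`11` covering (appended 2026-08-17) -/

/-- **Pasten's Lemma 6.10 for the exponents having a prime factor `≤ 13`, from Faltings' theorem
alone** (conductor form, at one exponent): for every `L ≥ 7` with `2 ∣ L`, `3 ∣ L`, `5 ∣ L`, `7 ∣ L`,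
`11 ∣ L` or `13 ∣ L` and every finite `S` there is `N₀` such that no elliptic curve `E/ℚ` semi-stable
away from `S` with `N_E ≥ N₀` has `|Δ_E| = n k^L` with all primes of `n` in `S` — granting only
Faltings' theorem; the covering of signature `(2, 3, L)` is the explicit dihedral, tetrahedral,
icosahedral, level-`7`, level-`11` or level-`13` one
(`finite_properSolutions_signature_r_two_three_of_faltings_of_dvd_le_thirteen`, the level-`11` one from
Klein's resolvent of degree `11` and three Kummer layers, `BelyiMapSignatureTwoThreeEleven`).
[cite: PastenShimura2024, Lemma 6.10 (§6.5, p. 22)]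
[cite: DarmonGranville1995, Theorem 2 (p. 515)] -/
theorem PastenLemma610.conductor_bounded_of_faltings_of_dvd_30030
    (hFaltings : ∀ (K' : Type) [Field K'] (F' : Type) [Field F'] [Algebra K' F'],
      finite_ratPlaces_of_two_le_genus K' F')
    {L : ℕ} (hL : 7 ≤ L) (h : 2 ∣ L ∨ 3 ∣ L ∨ 5 ∣ L ∨ 7 ∣ L ∨ 11 ∣ L ∨ 13 ∣ L) (S : Finset ℕ) :
    ∃ N₀ : ℕ, ∀ (W : WeierstrassCurve ℚ) [W.IsElliptic],
      (∀ p : ℕ, p.Prime → p ∉ S → ¬ p ^ 2 ∣ W.conductorNorm ℤ) → N₀ ≤ W.conductorNorm ℤ →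
      ∀ n k : ℕ, n.primeFactors ⊆ S → W.minimalDiscriminantNorm ℤ ≠ n * k ^ L :=
  PastenLemma610.conductor_bounded_of_finite_properSolutions (by omega)
    (fun _ _ _ hA hB hC =>
      finite_properSolutions_signature_r_two_three_of_faltings_of_dvd_le_thirteen hL h hFaltings hA hB hC) S

/-- **The finiteness form `h610` of Lemma 6.10 for the exponents having a prime factor `≤ 13`, from
Faltings' theorem alone.**
[cite: PastenShimura2024, Lemma 6.10 (§6.5, p. 22), last paragraph of the proof]
[cite: DarmonGranville1995, Theorem 2 (p. 515)] -/
theorem PastenLemma610.finite_minimalDiscriminantNorm_of_faltings_of_dvd_30030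
    (hFaltings : ∀ (K' : Type) [Field K'] (F' : Type) [Field F'] [Algebra K' F'],
      finite_ratPlaces_of_two_le_genus K' F')
    {L : ℕ} (hL : 7 ≤ L) (h : 2 ∣ L ∨ 3 ∣ L ∨ 5 ∣ L ∨ 7 ∣ L ∨ 11 ∣ L ∨ 13 ∣ L) (S : Finset ℕ) :
    {Δ : ℕ | ∃ (W : WeierstrassCurve ℚ) (_ : W.IsElliptic),
        (∀ q : ℕ, q.Prime → q ∉ S → ¬ q ^ 2 ∣ W.conductorNorm ℤ) ∧
        W.minimalDiscriminantNorm ℤ = Δ ∧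
        ∃ n k : ℕ, (∀ q : ℕ, q.Prime → q ∣ n → q ∈ S) ∧ Δ = n * k ^ L}.Finite :=
  PastenLemma610.finite_minimalDiscriminantNorm_of_finite_properSolutions (by omega)
    (fun _ _ _ hA hB hC =>
      finite_properSolutions_signature_r_two_three_of_faltings_of_dvd_le_thirteen hL h hFaltings hA hB hC) S

/-- **The named fact `PastenShimura2024_lemma_6_10` restricted to the exponents `L` with a prime factor
`≤ 13` holds modulo Faltings' theorem alone** — no Riemann existence theorem; what remains open in the
tree for the full fact is Faltings' theorem and, for `gcd(L, 30030) = 1` only, a covering of signature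
`(2, 3, p)` for the least prime factor `p ≥ 17` of `L`.
[cite: PastenShimura2024, Lemma 6.10 (§6.5, p. 22)] -/
theorem PastenShimura2024_lemma_6_10_of_faltings_of_dvd_30030
    (hFaltings : ∀ (K' : Type) [Field K'] (F' : Type) [Field F'] [Algebra K' F'],
      finite_ratPlaces_of_two_le_genus K' F') :
    ∀ (L : ℕ), 7 ≤ L → (2 ∣ L ∨ 3 ∣ L ∨ 5 ∣ L ∨ 7 ∣ L ∨ 11 ∣ L ∨ 13 ∣ L) → ∀ (S : Finset ℕ), ∃ N₀ : ℕ,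
      ∀ (W : WeierstrassCurve ℚ) [W.IsElliptic],
      (∀ p : ℕ, p.Prime → p ∉ S → ¬ p ^ 2 ∣ W.conductorNorm ℤ) → N₀ ≤ W.conductorNorm ℤ →
      ∀ n k : ℕ, n.primeFactors ⊆ S → W.minimalDiscriminantNorm ℤ ≠ n * k ^ L :=
  fun _ hL h S => PastenLemma610.conductor_bounded_of_faltings_of_dvd_30030 hFaltings hL h S

/-- **Pasten's Lemma 6.10 at every prime-power exponent `L = ℓ^a ≥ 7` with `ℓ ≤ 13`, from Faltings'
theorem alone** (the exponents `ℓ^m` at which the small-prime depth of the `Summits/ABC` crux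
`FewPrimeValuationProduct` applies the fact; the primes `ℓ ≥ 17` remain).
[cite: PastenShimura2024, Lemma 6.10 (§6.5, p. 22)] -/
theorem PastenLemma610.conductor_bounded_of_faltings_primePow_of_le_thirteen
    (hFaltings : ∀ (K' : Type) [Field K'] (F' : Type) [Field F'] [Algebra K' F'],
      finite_ratPlaces_of_two_le_genus K' F')
    {ℓ a : ℕ} (hℓ : ℓ.Prime) (hℓ13 : ℓ ≤ 13) (hL : 7 ≤ ℓ ^ a) (S : Finset ℕ) :
    ∃ N₀ : ℕ, ∀ (W : WeierstrassCurve ℚ) [W.IsElliptic],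
      (∀ p : ℕ, p.Prime → p ∉ S → ¬ p ^ 2 ∣ W.conductorNorm ℤ) → N₀ ≤ W.conductorNorm ℤ →
      ∀ n k : ℕ, n.primeFactors ⊆ S → W.minimalDiscriminantNorm ℤ ≠ n * k ^ (ℓ ^ a) := by
  have ha : a ≠ 0 := by rintro rfl; norm_num at hL
  have hdvd : ℓ ∣ ℓ ^ a := dvd_pow_self ℓ ha
  have h2 := hℓ.two_le
  have h : 2 ∣ ℓ ^ a ∨ 3 ∣ ℓ ^ a ∨ 5 ∣ ℓ ^ a ∨ 7 ∣ ℓ ^ a ∨ 11 ∣ ℓ ^ a ∨ 13 ∣ ℓ ^ a := by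
    interval_cases ℓ
    · exact Or.inl hdvd
    · exact Or.inr (Or.inl hdvd)
    · exact absurd hℓ (by norm_num)
    · exact Or.inr (Or.inr (Or.inl hdvd))
    · exact absurd hℓ (by norm_num)
    · exact Or.inr (Or.inr (Or.inr (Or.inl hdvd)))
    · exact absurd hℓ (by norm_num)
    · exact absurd hℓ (by norm_num)
    · exact absurd hℓ (by norm_num)
    · exact Or.inr (Or.inr (Or.inr (Or.inr (Or.inl hdvd))))
    · exact absurd hℓ (by norm_num)
    · exact Or.inr (Or.inr (Or.inr (Or.inr (Or.inr hdvd))))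
  exact PastenLemma610.conductor_bounded_of_faltings_of_dvd_30030 hFaltings hL h S

open scoped Polynomial in
open Polynomial AlgFunctionField in
/-- **What is left of the Riemann-existence input for the whole fact, after the level-`11` covering: one
covering of signature `(2, 3, p)` for each PRIME `p ≥ 17`.** `PastenShimura2024_lemma_6_10` follows from
Faltings' theorem and coverings of signature `(2, 3, p)` for the primes `p ≥ 17` only: for `L` with a
prime factor `≤ 13` the explicit coverings of `BelyiMapSignatureTwoThree{Even,Triple,Five,Seven,Eleven,
Thirteen}` serve (`PastenLemma610.conductor_bounded_of_faltings_of_dvd_30030`), and for `gcd(L, 30030) = 1`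
the least prime factor `p` of `L` is `≥ 17`, so one covering of signature `(2, 3, p)` (`p ∣ L`,
`(2, 3, p)` hyperbolic) and Faltings' theorem give the exponent `L`
(`PastenLemma610.finite_properSolutions_of_cover_of_faltings`). These coverings are classically the
modular curves `X(p) → X(1)` of genus `1 + (p² - 1)(p - 6)/24 ≥ 133`, none of which has a congruence
quotient of genus `0`; they are the genuine Riemann-existence (or modular-curve) input of the fact.
[cite: PastenShimura2024, Lemma 6.10 (§6.5, p. 22)]
[cite: DarmonGranville1995, Theorem 2 (p. 515), Prop. 3.1 (p. 525)] -/
theorem PastenShimura2024_lemma_6_10_of_primeSignatureCovers_of_faltings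
    (hCover : ∀ p : ℕ, p.Prime → 17 ≤ p →
      ∃ (K : Type) (_ : Field K) (_ : NumberField K) (F : Type) (_ : Field F) (_ : Algebra K F)
        (_ : IsAlgFunctionField K F) (_ : IsIntegrallyClosedIn K F) (f : F),
        f ∉ Set.range (algebraMap K F) ∧
        (∀ P : PlaceOver K F, 0 < P.ord f → P.ord f = 2) ∧
        (∀ P : PlaceOver K F, 0 < P.ord (f - 1) → P.ord (f - 1) = 3) ∧
        (∀ P : PlaceOver K F, P.ord f < 0 → P.ord f = -p) ∧
        (∀ π₀ : K[X], Irreducible π₀ → π₀.Monic → π₀ ≠ X → π₀ ≠ X - 1 →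
          ∀ P : PlaceOver K F, 0 < P.ord (aeval f π₀) → P.ord (aeval f π₀) = 1))
    (hFaltings : ∀ (K' : Type) [Field K'] (F' : Type) [Field F'] [Algebra K' F'],
      finite_ratPlaces_of_two_le_genus K' F') :
    PastenShimura2024_lemma_6_10 := by
  classical
  intro L hL S
  by_cases h : 2 ∣ L ∨ 3 ∣ L ∨ 5 ∣ L ∨ 7 ∣ L ∨ 11 ∣ L ∨ 13 ∣ L
  · exact PastenLemma610.conductor_bounded_of_faltings_of_dvd_30030 hFaltings hL h S
  -- `gcd(L, 30030) = 1`: the least prime factor `p` of `L` is `≥ 17`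
  simp only [not_or] at h
  obtain ⟨h2L, h3L, h5L, h7L, h11L, h13L⟩ := h
  have hL1 : L ≠ 1 := by omega
  have hp : (Nat.minFac L).Prime := Nat.minFac_prime hL1
  have hpL : Nat.minFac L ∣ L := Nat.minFac_dvd L
  have h17 : 17 ≤ Nat.minFac L := by
    by_contra hlt
    have key : ∀ p : ℕ, p.Prime → p < 17 → p ∣ L → False := by
      intro p hpp hp17 hpd
      have h2p := hpp.two_le
      interval_cases p
      · exact h2L hpd
      · exact h3L hpd
      · exact absurd hpp (by norm_num)
      · exact h5L hpd
      · exact absurd hpp (by norm_num)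
      · exact h7L hpd
      · exact absurd hpp (by norm_num)
      · exact absurd hpp (by norm_num)
      · exact absurd hpp (by norm_num)
      · exact h11L hpd
      · exact absurd hpp (by norm_num)
      · exact h13L hpd
      · exact absurd hpp (by norm_num)
      · exact absurd hpp (by norm_num)
      · exact absurd hpp (by norm_num)
    exact key _ hp (not_le.mp hlt) hpL
  obtain ⟨K, _, _, F, _, _, _, _, f, hf, h₀, h₁, hi, hunr⟩ := hCover _ hp h17
  exact PastenLemma610.conductor_bounded_of_finite_properSolutions (by omega)
    (fun _ _ _ hA hB hC => PastenLemma610.finite_properSolutions_of_cover_of_faltings (by omega) hpL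
      (by omega) hf h₀ h₁ hi hunr hFaltings hA hB hC) S

end Literature.NumberTheory.EllipticCurves
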